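import Summits.QuantumFields.YangMills.Theorems.LuscherReductionTwistedTraceScalingBOKernel
import Summits.QuantumFields.YangMills.Theorems.LuscherReductionTwistedTraceScalingBOAssemblyPrelim
import Summits.QuantumFields.YangMills.Theorems.LuscherReductionTwistedTraceScalingRecordAnalytic
import HarnessLib

/-!
# THE (B-OD) DOOR IN `L²(w)`: the off-diagonal Born–Oppenheimer brick from the WEIGHTED `L²` QUASIMODE DEFECT of `K̃(φ⊗Ω)`
# (lane A of S-BASE, crux `TwistedTraceScaling` stmt-QuantumFields-20203, C4-CORE, the (OD) pen; design note `pub/ym-fleet/ym-luscher-20007-p1/COARSE-DESIGN.md` §27)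

WHY THIS FILE.  The pointwise door `…BODoor.tubeCross_boFun_le_of_quasimode` (p677591) asks for the RELATIVE bound
`|Φ(oT u' v', u) − k·Ω(v̂')·w| ≤ η·k·Ω(v̂')·w` for ALL `v'`; where the profile vanishes (`Ω(v̂') = 0`, i.e. off the support ball of every admissible profile, field `hΩr`
of `RecordAnalyticInput`) it forces `Φ(oT u' v', u) = ∫ K̃·Ω dπ = 0`, which is false (`avgKernel_pos`, `orthoTransverse_ball_pos`): that hypothesis is unsatisfiable for the
profiles of record.  The door below replaces the pointwise-relative currency by the natural `L²` one and is sharp (it IS Cauchy–Schwarz):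

* §1 ★ `abs_integral_mul_le_of_defect` — abstract: if `∫ v·B·w = 0` and `F = (B + E)·w` on `supp v` then `|∫ v·F| ≤ ‖E‖_{L²(w)}·‖v‖_{L²(w)}` (finite measure, bounded data,
  `w ≥ 0`); `sq_integral_mul_mul_le` is the weighted Cauchy–Schwarz behind it.
* §2 ★ `tubeCross_comm` — `X(f,g) = X(g,f)` (Fubini + `avgKernel_symm`).
* §3 ★★★ `tubeCross_boFun_le_of_defect` — THE DOOR: for `v` fibrewise `w`-orthogonal to `Ω` (`∀ u, fibreInner L w Ω v u = 0`), ANY slow amplitude `ψ` and ANY defect `E` with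
  `K̃(boFun φ Ω)(U) = (boFun ψ Ω U + E U)·w U` on `supp v`:  `|X(boFun φ Ω, v)|, |X(v, boFun φ Ω)| ≤ √(∫ E²w)·√(tubeNormSq w v)`.  The coefficient `ψ` is free because
  `∫ v·(ψ⊗Ω)·w = ∫ ψ·fibreInner_w(Ω, v) = 0` (`integral_boFun_mul_eq`).  No positivity of `Ω`, no support condition, no tail bookkeeping: truncation tails, the gauge-far
  region and the stiff boundary layer are all just parts of `∫ E²w`.
* §4 ★★ `tubeCross_boFun_le_hOD_of_defect` — the hOD currency: `∫ E²w ≤ (b·Λ)²·tubeNormSq w (boFun φ Ω)` ⇒ `|X| ≤ b·Λ·√(tubeNormSq w (boFun φ Ω))·√(tubeNormSq w v)` (both orders).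
* §5 `defect_of_weight_lower_bound` — how to manufacture `E` on a set `S ⊇ supp v` where `w ≥ w₀ > 0`: `E = 𝟙_S·(F/w − boFun ψ Ω)` is bounded measurable and satisfies §3's
  identity (for the record weight, `w = N/χ ≥ N ≥ N̄(1 − Cδ²)` on the fat tube by `…FPWeightCore`).
* §6 ★★★ `hOD_of_defect` — the `∀ᶠ β` wrapper producing LITERALLY the field `hOD` of `RecordAnalyticInput` (any profile family `Ω`, weight `softWeight (χ β)`, window
  `orbitDist < δ₁ β`, level `Λ β`, rate `b β`) from: eventually, every admissible slow amplitude `φ` has a dual BO function `boFun ψ (Ω β)` and a defect `E` with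
  `K̃(boFun φ (Ω β)) = (boFun ψ (Ω β) + E)·w` on `{χ β ≠ 0}` and `∫ E²w ≤ (b β·Λ β)²·‖boFun φ (Ω β)‖²_w`.
WHAT (B-OD) NOW OWES (COARSE-DESIGN §27): the `L²(w)`-quasimode estimate `∫_{χ≠0} (K̃(φ⊗Ω_G) − (k̃φ)⊗Ω_G·w)²/w ≤ (bσλ₀)²‖φ⊗Ω_G‖²_w`, `b = O(β^{-s}log²β + β^{-1/2}log⁴β)`, via the
exact transport `K(oT u v, g·oT u' v') = [K₁(u,u')/K₁(1,1)]·K(oT 1 v, g·oT 1 v')·e^{offX + diagX}` (`…BTOffDiagonalRatio`, `…BTDiagonalRatio`) to the CENTRAL fibre `u = u' = 1`.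
HONEST FRAMING: a reduction (Cauchy–Schwarz) only; the quasimode estimate is OPEN; C4-CORE OPEN; stub of a child of the CONDITIONAL route R2b1; not infinite volume, not a gap,
not Clay.
-/

set_option autoImplicit false

noncomputable section

open MeasureTheory Filter Topology Real
open scoped BigOperators
open Literature.MathematicalPhysics.QuantumFieldTheory
open Literature.MathematicalPhysics.QuantumLattice

namespace Summit.QuantumFields.YangMills.Theorems.FemtoTransferGap.TwoLattice.ConstTube

open Summit.QuantumFields.YangMills.Theorems.FemtoTransferGap
open Summit.QuantumFields.YangMills.Theorems.FemtoTransferGap.TwoLattice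
open Summit.QuantumFields.YangMills.Theorems.FemtoTransferGap.TwoLattice.Avg
open Summit.QuantumFields.YangMills.Theorems.FemtoTransferGap.TwoLattice.Stiff (LinkSpace)

/-! ## §1 The abstract door: weighted Cauchy–Schwarz against a free orthogonal coefficient -/

section Abstract

variable {X : Type*} [MeasurableSpace X] (μ : Measure X) [IsFiniteMeasure μ]

/-- **Weighted Cauchy–Schwarz** `(∫ a·b·w)² ≤ (∫ a²·w)·(∫ b²·w)` for bounded measurable `a, b` and a bounded measurable weight `w ≥ 0` on a finite measure space.
[folklore] -/
theorem sq_integral_mul_mul_le {a b w : X → ℝ} (ha : Measurable a) (hb : Measurable b) (hw : Measurable w) {Ca Cb Cw : ℝ} (hCa : ∀ x, |a x| ≤ Ca)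
    (hCb : ∀ x, |b x| ≤ Cb) (hCw : ∀ x, |w x| ≤ Cw) (hw0 : ∀ x, 0 ≤ w x) :
    (∫ x, a x * b x * w x ∂μ) ^ 2 ≤ (∫ x, a x ^ 2 * w x ∂μ) * ∫ x, b x ^ 2 * w x ∂μ := by
  have iA : Integrable (fun x => a x ^ 2 * w x) μ :=
    integrable_of_measurable_abs_le μ ((ha.pow_const 2).mul hw) (C := Ca ^ 2 * Cw) fun x => by
      have hCa0 : 0 ≤ Ca := (abs_nonneg _).trans (hCa x)
      rw [abs_mul, abs_pow]
      exact mul_le_mul (pow_le_pow_left₀ (abs_nonneg _) (hCa x) 2) (hCw x) (abs_nonneg _) (pow_nonneg hCa0 2)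
  have iB : Integrable (fun x => b x ^ 2 * w x) μ :=
    integrable_of_measurable_abs_le μ ((hb.pow_const 2).mul hw) (C := Cb ^ 2 * Cw) fun x => by
      have hCb0 : 0 ≤ Cb := (abs_nonneg _).trans (hCb x)
      rw [abs_mul, abs_pow]
      exact mul_le_mul (pow_le_pow_left₀ (abs_nonneg _) (hCb x) 2) (hCw x) (abs_nonneg _) (pow_nonneg hCb0 2)
  have iC : Integrable (fun x => a x * b x * w x) μ :=
    integrable_of_measurable_abs_le μ ((ha.mul hb).mul hw) (C := Ca * Cb * Cw) fun x => by
      have hCa0 : 0 ≤ Ca := (abs_nonneg _).trans (hCa x)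
      have hCb0 : 0 ≤ Cb := (abs_nonneg _).trans (hCb x)
      rw [abs_mul, abs_mul]
      exact mul_le_mul (mul_le_mul (hCa x) (hCb x) (abs_nonneg _) hCa0) (hCw x) (abs_nonneg _) (mul_nonneg hCa0 hCb0)
  -- the quadratic `t ↦ ∫ (t·a + b)²·w ≥ 0`
  have key : ∀ t : ℝ, 0 ≤ (∫ x, a x ^ 2 * w x ∂μ) * (t * t) + (2 * ∫ x, a x * b x * w x ∂μ) * t + ∫ x, b x ^ 2 * w x ∂μ := by
    intro t
    have hnn : 0 ≤ ∫ x, (t * a x + b x) ^ 2 * w x ∂μ := integral_nonneg fun x => mul_nonneg (sq_nonneg _) (hw0 x)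
    have hpt : (fun x => (t * a x + b x) ^ 2 * w x) = fun x => t * t * (a x ^ 2 * w x) + 2 * t * (a x * b x * w x) + b x ^ 2 * w x := by
      funext x; ring
    have iA' : Integrable (fun x => t * t * (a x ^ 2 * w x)) μ := iA.const_mul _
    have iC' : Integrable (fun x => 2 * t * (a x * b x * w x)) μ := iC.const_mul _
    have iAC : Integrable (fun x => t * t * (a x ^ 2 * w x) + 2 * t * (a x * b x * w x)) μ := iA'.add iC'
    have hsplit : ∫ x, (t * a x + b x) ^ 2 * w x ∂μ = t * t * ∫ x, a x ^ 2 * w x ∂μ + 2 * t * ∫ x, a x * b x * w x ∂μ + ∫ x, b x ^ 2 * w x ∂μ := by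
      rw [hpt, integral_add iAC iB, integral_add iA' iC', integral_const_mul, integral_const_mul]
    rw [hsplit] at hnn
    linarith
  have hd := discrim_le_zero key
  rw [discrim] at hd
  nlinarith [hd]

/-- ★ **THE ABSTRACT DOOR.**  If `v` is `w`-orthogonal to `B` (`∫ v·B·w = 0`) and `F = (B + E)·w` on `supp v`, then `|∫ v·F| ≤ √(∫ E²·w)·√(∫ v²·w)`: the pairing of `v` with `F`
only sees the defect `E`, whatever the coefficient `B`. (Bounded measurable `v, B, E, w`; `w ≥ 0`; `F` arbitrary.) [cite: SjostrandZworski2007, §2] -/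
theorem abs_integral_mul_le_of_defect {F v B E w : X → ℝ} (hv : Measurable v) (hB : Measurable B) (hE : Measurable E) (hw : Measurable w) {Cv CB CE Cw : ℝ}
    (hCv : ∀ x, |v x| ≤ Cv) (hCB : ∀ x, |B x| ≤ CB) (hCE : ∀ x, |E x| ≤ CE) (hCw : ∀ x, |w x| ≤ Cw) (hw0 : ∀ x, 0 ≤ w x)
    (horth : ∫ x, v x * B x * w x ∂μ = 0) (hF : ∀ x, v x ≠ 0 → F x = (B x + E x) * w x) :
    |∫ x, v x * F x ∂μ| ≤ Real.sqrt (∫ x, E x ^ 2 * w x ∂μ) * Real.sqrt (∫ x, v x ^ 2 * w x ∂μ) := by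
  -- `v·F = v·B·w + E·v·w` pointwise (both sides vanish where `v = 0`)
  have hpt : (fun x => v x * F x) = fun x => v x * B x * w x + E x * v x * w x := by
    funext x
    by_cases hx : v x = 0
    · rw [hx]; ring
    · rw [hF x hx]; ring
  have iB : Integrable (fun x => v x * B x * w x) μ :=
    integrable_of_measurable_abs_le μ ((hv.mul hB).mul hw) (C := Cv * CB * Cw) fun x => by
      have hCv0 : 0 ≤ Cv := (abs_nonneg _).trans (hCv x)
      have hCB0 : 0 ≤ CB := (abs_nonneg _).trans (hCB x)
      rw [abs_mul, abs_mul]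
      exact mul_le_mul (mul_le_mul (hCv x) (hCB x) (abs_nonneg _) hCv0) (hCw x) (abs_nonneg _) (mul_nonneg hCv0 hCB0)
  have iE : Integrable (fun x => E x * v x * w x) μ :=
    integrable_of_measurable_abs_le μ ((hE.mul hv).mul hw) (C := CE * Cv * Cw) fun x => by
      have hCv0 : 0 ≤ Cv := (abs_nonneg _).trans (hCv x)
      have hCE0 : 0 ≤ CE := (abs_nonneg _).trans (hCE x)
      rw [abs_mul, abs_mul]
      exact mul_le_mul (mul_le_mul (hCE x) (hCv x) (abs_nonneg _) hCE0) (hCw x) (abs_nonneg _) (mul_nonneg hCE0 hCv0)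
  rw [hpt, integral_add iB iE, horth, zero_add]
  -- Cauchy–Schwarz
  have hcs := sq_integral_mul_mul_le μ hE hv hw hCE hCv hCw hw0
  have hA0 : 0 ≤ ∫ x, E x ^ 2 * w x ∂μ := integral_nonneg fun x => mul_nonneg (sq_nonneg _) (hw0 x)
  have hB0 : 0 ≤ ∫ x, v x ^ 2 * w x ∂μ := integral_nonneg fun x => mul_nonneg (sq_nonneg _) (hw0 x)
  rw [← Real.sqrt_mul hA0, ← Real.sqrt_sq_eq_abs]
  exact Real.sqrt_le_sqrt hcs

end Abstract

variable {L : ℕ} [NeZero L]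

/-! ## §2 Symmetry of the bilinear tube form -/

/-- ★ **`X(f,g) = X(g,f)`** for bounded measurable `f, g` (Fubini on the product of the a-priori measures, `K̃` symmetric). [cite: SeilerLNP1982, §3] -/
theorem tubeCross_comm (β : ℝ) {f g : GaugeConfig 3 L SU2 → ℝ} (hf : Measurable f) {Cf : ℝ} (hCf : ∀ U, |f U| ≤ Cf) (hg : Measurable g) {Cg : ℝ}
    (hCg : ∀ U, |g U| ≤ Cg) : tubeCross β f g = tubeCross β g f := by
  obtain ⟨M, hM0, hM⟩ := exists_avgKernel_le (L := L) β
  have hCf0 : 0 ≤ Cf := (abs_nonneg _).trans (hCf 1)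
  have hCg0 : 0 ≤ Cg := (abs_nonneg _).trans (hCg 1)
  have hFm : Measurable (Function.uncurry fun (U V : GaugeConfig 3 L SU2) => f U * avgKernel β U V * g V) :=
    ((hf.comp measurable_fst).mul (measurable_avgKernel β)).mul (hg.comp measurable_snd)
  have hFb : ∀ p : GaugeConfig 3 L SU2 × GaugeConfig 3 L SU2, |(Function.uncurry fun (U V : GaugeConfig 3 L SU2) => f U * avgKernel β U V * g V) p| ≤ Cf * M * Cg := by
    intro p
    simp only [Function.uncurry]
    rw [abs_mul, abs_mul, abs_of_pos (avgKernel_pos β _ _)]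
    exact mul_le_mul (mul_le_mul (hCf _) (hM _ _) (avgKernel_pos β _ _).le hCf0) (hCg _) (abs_nonneg _) (mul_nonneg hCf0 hM0.le)
  have hint := integrable_of_measurable_abs_le ((configMeasure SU2 L).prod (configMeasure SU2 L)) hFm hFb
  unfold tubeCross
  rw [integral_integral_swap hint]
  refine integral_congr_ae (ae_of_all _ fun V => ?_)
  refine integral_congr_ae (ae_of_all _ fun U => ?_)
  dsimp only
  rw [avgKernel_symm β U V]; ring

/-! ## §3 ★★★ The door in tube currency -/

/-- The orthogonality that kills the coefficient: `∫ v·(boFun ψ Ω)·w = ∫ ψ(u)·fibreInner_w(Ω,v)(u) du = 0` when `v` is fibrewise `w`-orthogonal to `Ω`. [folklore] -/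
theorem integral_mul_boFun_mul_eq_zero {Ω : LinkSpace L → ℝ} (hΩm : Measurable Ω) {CΩ : ℝ} (hCΩ : ∀ x, |Ω x| ≤ CΩ)
    {w : GaugeConfig 3 L SU2 → ℝ} (hwm : Measurable w) {Cw : ℝ} (hCw : ∀ U, |w U| ≤ Cw)
    {v : GaugeConfig 3 L SU2 → ℝ} (hvm : Measurable v) {Cv : ℝ} (hCv : ∀ U, |v U| ≤ Cv) (horth : ∀ u, fibreInner L w Ω v u = 0)
    {ψ : GaugeConfig 3 1 SU2 → ℝ} (hψm : Measurable ψ) {Cψ : ℝ} (hCψ : ∀ u, |ψ u| ≤ Cψ) :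
    ∫ U, v U * boFun L ψ Ω U * w U ∂configMeasure SU2 L = 0 := by
  have e : (fun U => v U * boFun L ψ Ω U * w U) = fun U => boFun L ψ Ω U * v U * w U := funext fun U => by ring
  rw [e, integral_boFun_mul_eq hψm hCψ hΩm hCΩ hvm hCv hwm hCw]
  have e2 : (fun u => ψ u * fibreInner L w Ω v u) = fun _ => (0 : ℝ) := funext fun u => by rw [horth u, mul_zero]
  rw [e2, integral_zero]

/-- ★★★ **THE (B-OD) DOOR IN `L²(w)`.**  Let `v` be fibrewise `w`-orthogonal to `Ω` and suppose the transfer of the BO function decomposes on `supp v` as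
`K̃(boFun φ Ω)(U) = (boFun ψ Ω U + E U)·w U` for SOME bounded measurable slow amplitude `ψ` and defect `E`.  Then
`|X(boFun φ Ω, v)| ≤ √(∫ E²w)·√(tubeNormSq w v)` and the same for `X(v, boFun φ Ω)`. [cite: Luscher1983, §3] [cite: SjostrandZworski2007, §2] -/
theorem tubeCross_boFun_le_of_defect (β : ℝ) {Ω : LinkSpace L → ℝ} (hΩm : Measurable Ω) {CΩ : ℝ} (hCΩ : ∀ x, |Ω x| ≤ CΩ)
    {w : GaugeConfig 3 L SU2 → ℝ} (hwm : Measurable w) {Cw : ℝ} (hCw : ∀ U, |w U| ≤ Cw) (hw0 : ∀ U, 0 ≤ w U)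
    {φ : GaugeConfig 3 1 SU2 → ℝ} (hφm : Measurable φ) {Cφ : ℝ} (hCφ : ∀ u, |φ u| ≤ Cφ)
    {v : GaugeConfig 3 L SU2 → ℝ} (hvm : Measurable v) {Cv : ℝ} (hCv : ∀ U, |v U| ≤ Cv) (horth : ∀ u, fibreInner L w Ω v u = 0)
    {ψ : GaugeConfig 3 1 SU2 → ℝ} (hψm : Measurable ψ) {Cψ : ℝ} (hCψ : ∀ u, |ψ u| ≤ Cψ)
    {E : GaugeConfig 3 L SU2 → ℝ} (hEm : Measurable E) {CE : ℝ} (hCE : ∀ U, |E U| ≤ CE)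
    (hF : ∀ U, v U ≠ 0 → ∫ V, avgKernel β U V * boFun L φ Ω V ∂configMeasure SU2 L = (boFun L ψ Ω U + E U) * w U) :
    |tubeCross β (boFun L φ Ω) v| ≤ Real.sqrt (∫ U, E U ^ 2 * w U ∂configMeasure SU2 L) * Real.sqrt (tubeNormSq w v) ∧
      |tubeCross β v (boFun L φ Ω)| ≤ Real.sqrt (∫ U, E U ^ 2 * w U ∂configMeasure SU2 L) * Real.sqrt (tubeNormSq w v) := by
  have h2 : |tubeCross β v (boFun L φ Ω)| ≤ Real.sqrt (∫ U, E U ^ 2 * w U ∂configMeasure SU2 L) * Real.sqrt (tubeNormSq w v) := by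
    rw [tubeCross_eq_integral_mul]
    unfold tubeNormSq
    exact abs_integral_mul_le_of_defect (configMeasure SU2 L) hvm (measurable_boFun L hψm hΩm) hEm hwm hCv (abs_boFun_le L hCψ hCΩ) hCE hCw hw0
      (integral_mul_boFun_mul_eq_zero hΩm hCΩ hwm hCw hvm hCv horth hψm hCψ) hF
  refine ⟨?_, h2⟩
  rw [tubeCross_comm β (measurable_boFun L hφm hΩm) (abs_boFun_le L hCφ hCΩ) hvm hCv]
  exact h2

/-! ## §4 ★★ The hOD currency -/

/-- `0 ≤ tubeNormSq w f` for `w ≥ 0`. [folklore] -/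
theorem tubeNormSq_nonneg' {w : GaugeConfig 3 L SU2 → ℝ} (hw0 : ∀ U, 0 ≤ w U) (f : GaugeConfig 3 L SU2 → ℝ) : 0 ≤ tubeNormSq w f :=
  integral_nonneg fun U => mul_nonneg (sq_nonneg _) (hw0 U)

/-- ★★ **(B-OD) IN hOD CURRENCY FROM THE DEFECT.**  With the data of `tubeCross_boFun_le_of_defect`, if `∫ E²w ≤ (b·Λ)²·tubeNormSq w (boFun φ Ω)` (`b, Λ ≥ 0`) then
`|X(boFun φ Ω, v)|, |X(v, boFun φ Ω)| ≤ b·Λ·√(tubeNormSq w (boFun φ Ω))·√(tubeNormSq w v)` — the two inequalities of the field `hOD` (with `Λ = σλ₀`).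
[cite: Luscher1983, §3] [cite: SjostrandZworski2007, §2] -/
theorem tubeCross_boFun_le_hOD_of_defect (β : ℝ) {Ω : LinkSpace L → ℝ} (hΩm : Measurable Ω) {CΩ : ℝ} (hCΩ : ∀ x, |Ω x| ≤ CΩ)
    {w : GaugeConfig 3 L SU2 → ℝ} (hwm : Measurable w) {Cw : ℝ} (hCw : ∀ U, |w U| ≤ Cw) (hw0 : ∀ U, 0 ≤ w U)
    {φ : GaugeConfig 3 1 SU2 → ℝ} (hφm : Measurable φ) {Cφ : ℝ} (hCφ : ∀ u, |φ u| ≤ Cφ)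
    {v : GaugeConfig 3 L SU2 → ℝ} (hvm : Measurable v) {Cv : ℝ} (hCv : ∀ U, |v U| ≤ Cv) (horth : ∀ u, fibreInner L w Ω v u = 0)
    {ψ : GaugeConfig 3 1 SU2 → ℝ} (hψm : Measurable ψ) {Cψ : ℝ} (hCψ : ∀ u, |ψ u| ≤ Cψ)
    {E : GaugeConfig 3 L SU2 → ℝ} (hEm : Measurable E) {CE : ℝ} (hCE : ∀ U, |E U| ≤ CE)
    (hF : ∀ U, v U ≠ 0 → ∫ V, avgKernel β U V * boFun L φ Ω V ∂configMeasure SU2 L = (boFun L ψ Ω U + E U) * w U)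
    {b Λ : ℝ} (hb : 0 ≤ b) (hΛ : 0 ≤ Λ) (hD : ∫ U, E U ^ 2 * w U ∂configMeasure SU2 L ≤ (b * Λ) ^ 2 * tubeNormSq w (boFun L φ Ω)) :
    |tubeCross β (boFun L φ Ω) v| ≤ b * Λ * Real.sqrt (tubeNormSq w (boFun L φ Ω)) * Real.sqrt (tubeNormSq w v) ∧
      |tubeCross β v (boFun L φ Ω)| ≤ b * Λ * Real.sqrt (tubeNormSq w (boFun L φ Ω)) * Real.sqrt (tubeNormSq w v) := by
  obtain ⟨h1, h2⟩ := tubeCross_boFun_le_of_defect β hΩm hCΩ hwm hCw hw0 hφm hCφ hvm hCv horth hψm hCψ hEm hCE hF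
  have hT0 : 0 ≤ tubeNormSq w (boFun L φ Ω) := tubeNormSq_nonneg' hw0 _
  have hsq : Real.sqrt (∫ U, E U ^ 2 * w U ∂configMeasure SU2 L) ≤ b * Λ * Real.sqrt (tubeNormSq w (boFun L φ Ω)) := by
    calc Real.sqrt (∫ U, E U ^ 2 * w U ∂configMeasure SU2 L) ≤ Real.sqrt ((b * Λ) ^ 2 * tubeNormSq w (boFun L φ Ω)) := Real.sqrt_le_sqrt hD
      _ = b * Λ * Real.sqrt (tubeNormSq w (boFun L φ Ω)) := by
          rw [Real.sqrt_mul (sq_nonneg _), Real.sqrt_sq (mul_nonneg hb hΛ)]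
  have hv0 : 0 ≤ Real.sqrt (tubeNormSq w v) := Real.sqrt_nonneg _
  exact ⟨h1.trans (mul_le_mul_of_nonneg_right hsq hv0), h2.trans (mul_le_mul_of_nonneg_right hsq hv0)⟩

/-! ## §5 Manufacturing the defect where the weight is bounded below -/

/-- **The defect by division.**  On a measurable set `S ⊇ supp v` where `w ≥ w₀ > 0`, `E := 𝟙_S·(F/w − boFun ψ Ω)` is bounded measurable and `F = (boFun ψ Ω + E)·w` on `supp v`
(bounded measurable `F`, `ψ`, `Ω`). [folklore] -/
theorem defect_of_weight_lower_bound {Ω : LinkSpace L → ℝ} (hΩm : Measurable Ω) {CΩ : ℝ} (hCΩ : ∀ x, |Ω x| ≤ CΩ)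
    {w : GaugeConfig 3 L SU2 → ℝ} (hwm : Measurable w) {S : Set (GaugeConfig 3 L SU2)} (hS : MeasurableSet S) {w₀ : ℝ} (hw₀ : 0 < w₀) (hwS : ∀ U ∈ S, w₀ ≤ w U)
    {v : GaugeConfig 3 L SU2 → ℝ} (hvS : ∀ U, v U ≠ 0 → U ∈ S) {ψ : GaugeConfig 3 1 SU2 → ℝ} (hψm : Measurable ψ) {Cψ : ℝ} (hCψ : ∀ u, |ψ u| ≤ Cψ)
    {F : GaugeConfig 3 L SU2 → ℝ} (hFm : Measurable F) {CF : ℝ} (hCF : ∀ U, |F U| ≤ CF) :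
    Measurable (S.indicator fun U => F U / w U - boFun L ψ Ω U) ∧
      (∀ U, |S.indicator (fun U => F U / w U - boFun L ψ Ω U) U| ≤ CF / w₀ + Cψ * CΩ) ∧
      ∀ U, v U ≠ 0 → F U = (boFun L ψ Ω U + S.indicator (fun U => F U / w U - boFun L ψ Ω U) U) * w U := by
  have hCF0 : 0 ≤ CF := (abs_nonneg _).trans (hCF 1)
  have hCψ0 : 0 ≤ Cψ := (abs_nonneg _).trans (hCψ 1)
  have hCΩ0 : 0 ≤ CΩ := (abs_nonneg _).trans (hCΩ 0)
  refine ⟨((hFm.div hwm).sub (measurable_boFun L hψm hΩm)).indicator hS, fun U => ?_, fun U hU => ?_⟩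
  · by_cases hUS : U ∈ S
    · rw [Set.indicator_of_mem hUS]
      have hwU : w₀ ≤ w U := hwS U hUS
      have hwpos : 0 < w U := hw₀.trans_le hwU
      have h1 : |F U / w U| ≤ CF / w₀ := by
        rw [abs_div, abs_of_pos hwpos]
        exact div_le_div₀ hCF0 (hCF U) hw₀ hwU
      have h2 := abs_boFun_le L hCψ hCΩ U (φ := ψ) (Ω := Ω)
      exact (abs_sub _ _).trans (add_le_add h1 h2)
    · rw [Set.indicator_of_notMem hUS, abs_zero]; positivity
  · have hUS : U ∈ S := hvS U hU
    rw [Set.indicator_of_mem hUS]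
    have hwpos : 0 < w U := hw₀.trans_le (hwS U hUS)
    field_simp
    ring

/-! ## §6 ★★★ The `∀ᶠ β` wrapper: the field `hOD` of `RecordAnalyticInput` from the `L²(w)` quasimode defect -/

/-- ★★★ **hOD FROM THE DEFECT (family form).**  For a profile family `Ω` (`|Ω| ≤ 1`, measurable), weights `w_β = softWeight (χ β)` (measurable, bounded, `≥ 0`), a slow
window `orbitDist < δ₁ β`, a level `Λ β ≥ 0` and a rate `b β ≥ 0`: if eventually every bounded measurable `φ` supported in the window has a dual slow amplitude `ψ` and a
defect `E` with `K̃(boFun φ (Ω β)) = (boFun ψ (Ω β) + E)·w_β` on `{χ β ≠ 0}` and `∫ E²w_β ≤ (b β·Λ β)²·‖boFun φ (Ω β)‖²_{w_β}`, then the field `hOD` holds VERBATIM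
(weight `χ`, window `δ₁`, level `Λ`). [cite: Luscher1983, §3] [cite: SjostrandZworski2007, §2] -/
theorem hOD_of_defect {Ω : ℝ → LinkSpace L → ℝ} (hΩm : ∀ β, Measurable (Ω β)) (hΩ1 : ∀ β x, |Ω β x| ≤ 1)
    {χ : ℝ → GaugeConfig 3 L SU2 → ℝ} (hw : ∀ β, Measurable (softWeight (χ β)) ∧ (∃ C : ℝ, ∀ U, |softWeight (χ β) U| ≤ C) ∧ ∀ U, 0 ≤ softWeight (χ β) U)
    {δ₁ Λ b : ℝ → ℝ} (hΛ : ∀ᶠ β in atTop, 0 ≤ Λ β) (hb : ∀ β, 0 ≤ b β)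
    (hdef : ∀ᶠ β in atTop, ∀ φ : GaugeConfig 3 1 SU2 → ℝ, Measurable φ → (∃ C : ℝ, ∀ u, |φ u| ≤ C) → (∀ u, φ u ≠ 0 → orbitDist u < δ₁ β) →
      ∃ (ψ : GaugeConfig 3 1 SU2 → ℝ) (E : GaugeConfig 3 L SU2 → ℝ), Measurable ψ ∧ (∃ C : ℝ, ∀ u, |ψ u| ≤ C) ∧ Measurable E ∧ (∃ C : ℝ, ∀ U, |E U| ≤ C) ∧
        (∀ U, χ β U ≠ 0 → ∫ V, avgKernel β U V * boFun L φ (Ω β) V ∂configMeasure SU2 L = (boFun L ψ (Ω β) U + E U) * softWeight (χ β) U) ∧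
        ∫ U, E U ^ 2 * softWeight (χ β) U ∂configMeasure SU2 L ≤ (b β * Λ β) ^ 2 * tubeNormSq (softWeight (χ β)) (boFun L φ (Ω β))) :
    ∀ᶠ β in atTop, ∀ (φ : GaugeConfig 3 1 SU2 → ℝ) (v : GaugeConfig 3 L SU2 → ℝ), Measurable φ → (∃ C : ℝ, ∀ u, |φ u| ≤ C) →
      (∀ u, φ u ≠ 0 → orbitDist u < δ₁ β) → Measurable v → (∃ C : ℝ, ∀ U, |v U| ≤ C) → (∀ U, v U ≠ 0 → χ β U ≠ 0) →
      (∀ u, fibreInner L (softWeight (χ β)) (Ω β) v u = 0) →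
      |tubeCross β (boFun L φ (Ω β)) v| ≤ b β * Λ β * Real.sqrt (tubeNormSq (softWeight (χ β)) (boFun L φ (Ω β))) * Real.sqrt (tubeNormSq (softWeight (χ β)) v) ∧
      |tubeCross β v (boFun L φ (Ω β))| ≤ b β * Λ β * Real.sqrt (tubeNormSq (softWeight (χ β)) (boFun L φ (Ω β))) * Real.sqrt (tubeNormSq (softWeight (χ β)) v) := by
  filter_upwards [hdef, hΛ] with β hβ hΛβ φ v hφm hφb hφs hvm hvb hvχ horth
  obtain ⟨Cφ, hCφ⟩ := hφb
  obtain ⟨Cv, hCv⟩ := hvb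
  obtain ⟨ψ, E, hψm, ⟨Cψ, hCψ⟩, hEm, ⟨CE, hCE⟩, hF, hD⟩ := hβ φ hφm ⟨Cφ, hCφ⟩ hφs
  obtain ⟨hwm, ⟨Cw, hCw⟩, hw0⟩ := hw β
  exact tubeCross_boFun_le_hOD_of_defect β (hΩm β) (hΩ1 β) hwm hCw hw0 hφm hCφ hvm hCv horth hψm hCψ hEm hCE (fun U hU => hF U (hvχ U hU)) (hb β) hΛβ hD

end Summit.QuantumFields.YangMills.Theorems.FemtoTransferGap.TwoLattice.ConstTube

end
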